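import Mathlib
import HarnessLib
import Summits.HubbardSuperconductivity.HubbardSuperconductivity.Theorems.KLProgrammeKLRegimeEngineTowerLipschitz

/-!
# Route `KLProgramme` — crux K3 ENGINE (stmt-HubbardSuperconductivity-20437 `KLRegimeEngineV17F2`), stub (e) proof-input «(e)-D-ROWS»: THE LIPSCHITZ TOWER IN
# PROFILE FORM, RE-BASED, TOKEN CARRIED — the two-volume twin of `towerBorn_le_law_tracks_of_profile_base_tok` (…BookkeepingProfileTok, one track)
# (seat hubbard-kl-k3c4-p1 g24, VL lane, the consumer of T3-Lip₄; E1 may rename or supersede; DROWS-SCOPE-g24 v8 §10.2/§10.5)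

`towerBornDiff_le_law₄` (…EngineTowerLipschitz, T3-Lip₄) derives the measured-difference profile of block `k` INTERNALLY from the source-free re-measurement row
`dμ k m ≤ Σ_{k′≤k} c₁c₂^m g^{(m−2)(k+1−k′)} db k′ m` and a UV row `db 0`.  The one-volume kit has since moved to the PROFILE form (the caller supplies the bridge
«law on the born arrays of the blocks `2 … k` ⇒ profile of the measured array of block `k`», re-based at block `1`, token `Zk` threaded: W1
`…EngineTowerWtLawBaseTokX.klTowerBornWtAt_le_law_of_inputs_base_tokX` over `towerBorn_le_law_tracks_of_profile_base_tok`).  The two-volume (Lipschitz) tower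
needs the same form, for the same reason and one more: its re-measurement row (`…TwoVolumeLipRemeasureSup.klLipInputDiffSup_le_remeasured`) carries SOURCES
(transfer far tails, the base), which the caller folds into its budget `R` when it proves the bridge.  This file is T3-Lip₄ with exactly that change:

* **`towerBornDiff_le_law_of_profile_tok`** — data: born differences `db k p` (block `k ≥ 2` ↦ the output of block `k−1`), measured differences `dμ k m ≥ 0`,
  common majorants `μb k m ≥ 0` with the four-piece profile (the one-volume towers are closed), a nondecreasing RELATIVE budget `R` (`0 ≤ R 1`,
  `R k + s k ≤ R (k+1)`, `0 ≤ s`), a token `Zk` (`Zk 1`, propagation under the kit's guard); hypotheses: the DIFFERENCE BRIDGE `hprofd` (law with budget `R k′` on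
  `db k′`, `2 ≤ k′ ≤ k` ⇒ `dμ k m ≤ R k·A′λ^{m−1}Q′^m`, `4 ≤ m ≤ D`) and `hprofd3` (six legs, `≤ R k·ι₃λ²`), the difference imports `dμ k 1 ≤ R k·ι₁λ`,
  `dμ k 2 ≤ R k·ι₂λ`, the LIPSCHITZ STEP of `towerLipStep_le_of_chernoff` at every block `1 ≤ k < K` under the token (first order linear in `dμ k`, telescoped
  graded orders `towerSLip D τ (dμ k) (μb k)`, `Ct`-tails of the majorant, a source `src k p ≤ s k·Aλ^{p−1}Q^p`), and T3-Lip₄'s numerics verbatim (Lipschitz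
  closing inequality with `(2y − y²)/(1 − y)²`); conclusion: the token at every block `1 ≤ k ≤ K` and **`db k p ≤ R k·Aλ^{p−1}Q^p` for `2 ≤ k ≤ K`, `3 ≤ p ≤ D`**.
Proof = T3-Lip₄'s induction step verbatim with the internal `towerMeasured_le_profile` / `towerMeasured_three_le` replaced by the bridge hypotheses.
Pure real analysis; nothing about the model is asserted; nothing asserts the (D) rows, stub (e), VL, K3 or superconductivity.
References: Benfatto–Giuliani–Mastropietro 2006 §2.8 (2.93)–(2.98), §3 [cite: BenfattoGiulianiMastropietro2006]; Gawȩdzki–Kupiainen 1985 §3.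
-/

noncomputable section

namespace Summit.HubbardSuperconductivity.HubbardSuperconductivity.Theorems.EngineV8

set_option linter.dupNamespace false -- summit = problem name (single-conjunct summit), D-0017

open Real Finset

/-- **(T3-Lip, profile form, re-based, token carried) The Lipschitz tower closes from a caller-supplied difference bridge; the relative budget is additive.**
See the module docstring for the hypothesis list; `R k` multiplies every difference row of block `k`, the step adds `s k`, and `R k + s k ≤ R (k+1)`. -/
theorem towerBornDiff_le_law_of_profile_tok {D K : ℕ} {db dμ μb src : ℕ → ℕ → ℝ} {R s : ℕ → ℝ}
    {A lam Q σ Φ ψ τ A' Q' ι₁ ι₂ ι₃ Ct : ℝ} {Zk : ℕ → Prop}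
    (hD3 : 3 ≤ D) (hlam : 0 < lam) (hA : 0 ≤ A) (hQ : 0 ≤ Q)
    (hσ : 0 ≤ σ) (hΦ : 0 ≤ Φ) (hψ : 0 ≤ ψ) (hτ : 0 < τ) (hQ'0 : 0 < Q') (hA'0 : 0 ≤ A') (hCt : 0 ≤ Ct)
    (hdμ0 : ∀ k m, 0 ≤ dμ k m) (hμb0 : ∀ k m, 0 ≤ μb k m)
    (hs0 : ∀ k, 0 ≤ s k) (hR1 : 0 ≤ R 1) (hR : ∀ k, R k + s k ≤ R (k + 1))
    -- the token along the blocks: base, and propagation under the step's guard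
    (hZ1 : Zk 1) (hZsucc : ∀ k, 1 ≤ k → k < K → Zk k → Φ * towerV D τ (μb k) < 1 → Zk (k + 1))
    -- the common majorant's four-piece profile at every block 1 ≤ k < K (the one-volume towers are closed)
    (hῑ₁ : ∀ k, 1 ≤ k → k < K → μb k 1 ≤ ι₁ * lam) (hῑ₂ : ∀ k, 1 ≤ k → k < K → μb k 2 ≤ ι₂ * lam)
    (hῑ₃ : ∀ k, 1 ≤ k → k < K → μb k 3 ≤ ι₃ * lam ^ 2)
    (hprofb : ∀ k, 1 ≤ k → k < K → ∀ m, 4 ≤ m → m ≤ D → μb k m ≤ A' * lam ^ (m - 1) * Q' ^ m)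
    -- the difference bridge (re-based): relative law on the born differences of blocks 2 … k ⇒ relative profile of the measured difference at block k
    (hprofd : ∀ k, 1 ≤ k → k < K →
      (∀ k', 2 ≤ k' → k' ≤ k → ∀ p, 3 ≤ p → p ≤ D → db k' p ≤ R k' * (A * lam ^ (p - 1) * Q ^ p)) →
      ∀ m, 4 ≤ m → m ≤ D → dμ k m ≤ R k * (A' * lam ^ (m - 1) * Q' ^ m))
    (hprofd3 : ∀ k, 1 ≤ k → k < K → 3 ≤ D →
      (∀ k', 2 ≤ k' → k' ≤ k → ∀ p, 3 ≤ p → p ≤ D → db k' p ≤ R k' * (A * lam ^ (p - 1) * Q ^ p)) →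
      dμ k 3 ≤ R k * (ι₃ * lam ^ 2))
    (hdι₁ : ∀ k, 1 ≤ k → k < K → dμ k 1 ≤ R k * (ι₁ * lam)) (hdι₂ : ∀ k, 1 ≤ k → k < K → dμ k 2 ≤ R k * (ι₂ * lam))
    -- the Lipschitz step and its source at every block 1 ≤ k < K, under the token
    (hsrc : ∀ k, 1 ≤ k → k < K → ∀ p, 3 ≤ p → p ≤ D → src k p ≤ s k * (A * lam ^ (p - 1) * Q ^ p))
    (hstep : ∀ k, 1 ≤ k → k < K → Zk k → ∀ N : ℕ, 2 ≤ N → ∀ p, 3 ≤ p → p ≤ D → Φ * towerV D τ (μb k) < 1 →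
      db (k + 1) p ≤ towerFO D σ (dμ k) p + ∑ n ∈ Icc 2 N, exp 1 * Φ ^ (n - 1) * ψ ^ p * towerSLip D τ (dμ k) (μb k) n p +
        Ct * (ψ ^ p * exp 1 * towerV D τ (μb k) * (Φ * towerV D τ (μb k)) ^ N / (1 - Φ * towerV D τ (μb k))) + src k p)
    -- T3-Lip₄'s numerics
    (hx₁ : 4 * σ * lam * Q' < 1) (hx₂ : 2 * lam * τ * Q' ≤ 1) (hx₃ : exp 1 * τ * lam * Q' < 1)
    (hy : Φ * (τ * (ι₁ * lam + ι₂ / (2 * Q') + ι₃ / (4 * Q' ^ 2) + A' * Q' / 4)) < 1)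
    (hθ : Φ * (exp 1 * τ * (ι₁ * lam) + (exp 1 * τ) ^ 2 * (ι₂ * lam) + (exp 1 * τ) ^ 3 * (ι₃ * lam ^ 2) +
      A' * (exp 1 * τ * Q') * ((exp 1 * τ * lam * Q') ^ 3 / (1 - exp 1 * τ * lam * Q'))) < 1)
    (hu₁ : 4 * Q' ≤ Q) (hu₂ : 2 * τ * ψ * Q' ≤ Q)
    (hclose : A' * (4 * Q') ^ 3 * (4 * σ * lam * Q' / (1 - 4 * σ * lam * Q')) +
      exp 1 * ψ * (2 * τ * ψ * Q') ^ 2 * (τ * (ι₁ * lam + ι₂ / (2 * Q') + ι₃ / (4 * Q' ^ 2) + A' * Q' / 4)) *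
        ((2 * (Φ * (τ * (ι₁ * lam + ι₂ / (2 * Q') + ι₃ / (4 * Q' ^ 2) + A' * Q' / 4))) -
            (Φ * (τ * (ι₁ * lam + ι₂ / (2 * Q') + ι₃ / (4 * Q' ^ 2) + A' * Q' / 4))) ^ 2) /
          (1 - Φ * (τ * (ι₁ * lam + ι₂ / (2 * Q') + ι₃ / (4 * Q' ^ 2) + A' * Q' / 4))) ^ 2) ≤ A * Q ^ 3) :
    (∀ k, 1 ≤ k → k ≤ K → Zk k) ∧
      ∀ k, 2 ≤ k → k ≤ K → ∀ p, 3 ≤ p → p ≤ D → db k p ≤ R k * (A * lam ^ (p - 1) * Q ^ p) := by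
  have hx10 : 0 ≤ 4 * σ * lam * Q' / (1 - 4 * σ * lam * Q') := div_nonneg (by positivity) (sub_nonneg.2 hx₁.le)
  have hw : 1 ≤ (2 * τ * Q' * lam)⁻¹ := (one_le_inv₀ (by positivity)).2 (by linarith)
  have hRmono : ∀ {k' k}, k' ≤ k → R k' ≤ R k := fun h => budget_mono hs0 hR h
  set Y := ι₁ * lam + ι₂ / (2 * Q') + ι₃ / (4 * Q' ^ 2) + A' * Q' / 4 with hY
  suffices H : ∀ k, 1 ≤ k → k ≤ K → (∀ j, 1 ≤ j → j ≤ k → Zk j) ∧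
      ∀ k', 2 ≤ k' → k' ≤ k → ∀ p, 3 ≤ p → p ≤ D → db k' p ≤ R k' * (A * lam ^ (p - 1) * Q ^ p) from
    ⟨fun k hk1 hkK => (H k hk1 hkK).1 k hk1 le_rfl, fun k hk2 hkK p hp hpD => (H k (by omega) hkK).2 k hk2 le_rfl p hp hpD⟩
  intro k
  induction k with
  | zero => intro h; exact absurd h (by omega)
  | succ k ih =>
    intro _ hkK
    rcases Nat.eq_zero_or_pos k with rfl | hkpos
    · exact ⟨fun j hj1 hj2 => by obtain rfl : j = 1 := by omega
                                 exact hZ1, fun k' hk'2 hk'le => by omega⟩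
    · have hkK' : k < K := by omega
      obtain ⟨ihZ, ihB⟩ := ih hkpos hkK'.le
      have hZk : Zk k := ihZ k hkpos le_rfl
      have hVb := towerV_le_fourPiece hτ.le hlam.le hQ'0.le hA'0 (hμb0 k) (hῑ₁ k hkpos hkK') (hῑ₂ k hkpos hkK') (hῑ₃ k hkpos hkK')
        (hprofb k hkpos hkK') hx₃
      have hguard : Φ * towerV D τ (μb k) < 1 := (mul_le_mul_of_nonneg_left hVb hΦ).trans_lt hθ
      have hZk1 : Zk (k + 1) := hZsucc k hkpos hkK' hZk hguard
      refine ⟨fun j hj1 hj2 => ?_, fun k' hk'2 hk'le p hp hpD => ?_⟩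
      · rcases Nat.lt_or_ge j (k + 1) with hlt | hge
        · exact ihZ j hj1 (by omega)
        · rw [le_antisymm hj2 hge]; exact hZk1
      · rcases Nat.lt_or_ge k' (k + 1) with hlt | hge
        · exact ihB k' hk'2 (by omega) p hp hpD
        · rw [le_antisymm hk'le hge]
          -- THE STEP over block `k ≥ 1`: the relative profile of `dμ k` from the bridge, Chernoff data, T2-Lip, the closing inequality
          have hRk : 0 ≤ R k := hR1.trans (hRmono hkpos)
          have hprofd' : ∀ m, 4 ≤ m → m ≤ D → dμ k m ≤ (R k * A') * lam ^ (m - 1) * Q' ^ m := fun m hm hmD =>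
            (hprofd k hkpos hkK' ihB m hm hmD).trans_eq (by ring)
          have hdμ3' : dμ k 3 ≤ (R k * ι₃) * lam ^ 2 := (hprofd3 k hkpos hkK' hD3 ihB).trans_eq (by ring)
          have hdι₁' : dμ k 1 ≤ (R k * ι₁) * lam := (hdι₁ k hkpos hkK').trans_eq (by ring)
          have hdι₂' : dμ k 2 ≤ (R k * ι₂) * lam := (hdι₂ k hkpos hkK').trans_eq (by ring)
          have hGν := sum_fourPiece_le (D := D) (ι₁ := R k * ι₁) (ι₂ := R k * ι₂) (ι₃ := R k * ι₃) (A' := R k * A') hτ hlam hQ'0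
            (mul_nonneg hRk hA'0) (hdμ0 k) hdι₁' hdι₂' hdμ3' hprofd'
          have hGνeq : τ * (R k * ι₁ * lam + R k * ι₂ / (2 * Q') + R k * ι₃ / (4 * Q' ^ 2) + R k * A' * Q' / 4) = R k * (τ * Y) := by
            rw [hY]; ring
          rw [hGνeq] at hGν
          have hG := sum_fourPiece_le (D := D) hτ hlam hQ'0 hA'0 (hμb0 k) (hῑ₁ k hkpos hkK') (hῑ₂ k hkpos hkK') (hῑ₃ k hkpos hkK') (hprofb k hkpos hkK')
          have hG0 : 0 ≤ τ * Y := (sum_nonneg fun δ _ => by have := hμb0 k δ; positivity).trans hG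
          have hRG0 : 0 ≤ R k * (τ * Y) := mul_nonneg hRk hG0
          have hFO := towerFO_le_of_four_le hσ (mul_nonneg hRk hA'0) hlam.le hQ'0.le (hdμ0 k) hprofd' hx₁ hp (D := D)
          have hT2 := towerLipStep_le_of_chernoff (D := D) hΦ hψ hτ.le (hdμ0 k) (hμb0 k) hw hCt hFO hGν hG hVb hy hθ
            (fun N hN hg => hstep k hkpos hkK' hZk N hN p hp hpD hg)
          refine hT2.trans ?_
          have hinv : (((2 * τ * Q' * lam)⁻¹) ^ (p - 1))⁻¹ = (2 * τ * Q' * lam) ^ (p - 1) := by rw [inv_pow, inv_inv]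
          rw [hinv]
          set y := Φ * (τ * Y) with hy'
          have hy0 : 0 ≤ y := by positivity
          have hy1 : y ≤ 1 := hy.le
          have hZ0 : 0 ≤ (2 * y - y ^ 2) / (1 - y) ^ 2 := by
            refine div_nonneg ?_ (sq_nonneg _)
            rw [show 2 * y - y ^ 2 = y * (2 - y) by ring]
            exact mul_nonneg hy0 (by linarith only [hy1])
          obtain ⟨r, rfl⟩ : ∃ r, p = 3 + r := ⟨p - 3, by omega⟩
          have h4 : (4 * Q') ^ (3 + r) ≤ (4 * Q') ^ 3 * Q ^ r := by
            rw [pow_add]; exact mul_le_mul_of_nonneg_left (pow_le_pow_left₀ (by positivity) hu₁ r) (by positivity)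
          have h2 : ψ ^ (3 + r) * (2 * τ * Q' * lam) ^ (3 + r - 1) ≤ lam ^ (3 + r - 1) * ψ * ((2 * τ * ψ * Q') ^ 2 * Q ^ r) := by
            have heq : ψ ^ (3 + r) * (2 * τ * Q' * lam) ^ (3 + r - 1) = lam ^ (3 + r - 1) * ψ * ((2 * τ * ψ * Q') ^ 2 * (2 * τ * ψ * Q') ^ r) := by
              rw [show 3 + r - 1 = r + 2 by omega, show 3 + r = r + 2 + 1 by omega]
              ring
            rw [heq]
            have hr : (2 * τ * ψ * Q') ^ r ≤ Q ^ r := pow_le_pow_left₀ (by positivity) hu₂ r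
            exact mul_le_mul_of_nonneg_left (mul_le_mul_of_nonneg_left hr (by positivity)) (by positivity)
          set X₁ := 4 * σ * lam * Q' / (1 - 4 * σ * lam * Q') with hX₁
          set Z := (2 * y - y ^ 2) / (1 - y) ^ 2 with hZ
          have hsrc' := hsrc k hkpos hkK' (3 + r) hp hpD
          calc R k * A' * lam ^ (3 + r - 1) * (4 * Q') ^ (3 + r) * X₁ +
                exp 1 * ψ ^ (3 + r) * (2 * τ * Q' * lam) ^ (3 + r - 1) * (R k * (τ * Y)) * Z + src k (3 + r)
              ≤ R k * A' * lam ^ (3 + r - 1) * ((4 * Q') ^ 3 * Q ^ r) * X₁ +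
                exp 1 * (lam ^ (3 + r - 1) * ψ * ((2 * τ * ψ * Q') ^ 2 * Q ^ r)) * (R k * (τ * Y)) * Z +
                  s k * (A * lam ^ (3 + r - 1) * Q ^ (3 + r)) := by
                have : exp 1 * ψ ^ (3 + r) * (2 * τ * Q' * lam) ^ (3 + r - 1) = exp 1 * (ψ ^ (3 + r) * (2 * τ * Q' * lam) ^ (3 + r - 1)) := by
                  ring
                rw [this]
                gcongr
            _ = R k * (lam ^ (3 + r - 1) * Q ^ r * (A' * (4 * Q') ^ 3 * X₁ + exp 1 * ψ * (2 * τ * ψ * Q') ^ 2 * (τ * Y) * Z)) +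
                  s k * (A * lam ^ (3 + r - 1) * Q ^ (3 + r)) := by ring
            _ ≤ R k * (lam ^ (3 + r - 1) * Q ^ r * (A * Q ^ 3)) + s k * (A * lam ^ (3 + r - 1) * Q ^ (3 + r)) := by
                have := mul_le_mul_of_nonneg_left hclose (show 0 ≤ lam ^ (3 + r - 1) * Q ^ r by positivity)
                exact add_le_add_left (mul_le_mul_of_nonneg_left this hRk) _
            _ = (R k + s k) * (A * lam ^ (3 + r - 1) * Q ^ (3 + r)) := by rw [pow_add]; ring
            _ ≤ R (k + 1) * (A * lam ^ (3 + r - 1) * Q ^ (3 + r)) := mul_le_mul_of_nonneg_right (hR k) (by positivity)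


end Summit.HubbardSuperconductivity.HubbardSuperconductivity.Theorems.EngineV8

end
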